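/-
SIEGEL GATE — S-size RECORD EXCERPT (≤ 150 l) of `dh/SiegelGate.lean` (rh-idea-4 g4, L60; critic idea-crit-1 g2 PASS-WITH-PRICE
05:09:22Z priced exactly this excerpt: log-strength gate + door + trichotomy readings + Heilbronn's play + Siegel's shutting of the
power gate + a short BRIDGE from the tree's `Watkins2021.DeuringSpacing`, citing rather than duplicating).  All proved except the
named open door `DeuringDoor` (neither asserted nor denied).  Nothing here bears on the truth of RH; no summit is proved by a line.
-/
import Summits.RiemannHypothesis.RiemannHypothesis.Statement
import Literature.NumberTheory.LFunctions.DeuringZeroSpacingPhenomenon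
import Literature.NumberTheory.DiophantineGeometry.NamedHypothesesRHProofs
import HarnessLib

/-!
# «SIEGEL GATE» (B-candidate record, Z3 / T6): the Deuring–Heilbronn input against capped towers of `ζ`

An exceptional real character is the ONLY coupling through which characters / class numbers constrain individual zeros
of `ζ` (DH-L: tree `deuring_heilbronn`, near `σ = 1`; DH-D: onto `σ = ½` in a height window — POWER strength a theorem
in tree, `Watkins2021.DeuringSpacing` / `Stark1967_thm1_holds`, LOG strength a remark, Conrey–Iwaniec 2002 p.3).  The gate:
(G⁻) no exceptional modulus ⇒ the door is vacuous; (G⁰) finitely many ⇒ its content is RH up to ONE fixed height (B30 type);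
(G⁺) infinitely many ⇒ RH outright (Heilbronn 1934) — GRH-refuted at log strength, Siegel-refuted (PROVED) at power strength.
The integer `h(−q)` enters only as the real floor `L(1,χ) ≥ π/√q`.  [cite: ConreyIwaniec2002, Thm 1.2, §1]
[cite: Watkins2021DeuringZeroSpacing, Thm 1.1] [cite: Siegel1935] [cite: IwaniecConversations2006, §1]
-/

noncomputable section

set_option linter.dupNamespace false

open Complex Filter

namespace Summit.RiemannHypothesis.RiemannHypothesis.Theorems.Splittings.SiegelGate

open Literature.NumberTheory.LFunctions Literature.NumberTheory.DiophantineGeometry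

/-- `(log q)^{-A}`-exceptional modulus: `χ` real primitive mod `q > 4`, `|L(1,χ)| ≤ (log q)^{-A}`. -/
def Exceptional (A : ℝ) (q : ℕ) [NeZero q] (χ : DirichletCharacter ℂ q) : Prop :=
  4 < q ∧ χ.IsPrimitive ∧ χ.IsQuadratic ∧ ‖χ.LFunction 1‖ ≤ Real.log q ^ (-A)

/-- (G⁺): infinitely many exceptional moduli at strength `A`. -/
def GatePlus (A : ℝ) : Prop :=
  ∀ q₀ : ℕ, ∃ (q : ℕ) (_ : NeZero q) (χ : DirichletCharacter ℂ q), q₀ < q ∧ Exceptional A q χ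

/-- (G⁰): some but finitely many. -/
def GateZero (A : ℝ) : Prop :=
  (∃ (q : ℕ) (_ : NeZero q) (χ : DirichletCharacter ℂ q), Exceptional A q χ) ∧
    ∃ q₀ : ℕ, ∀ (q : ℕ) [NeZero q] (χ : DirichletCharacter ℂ q), Exceptional A q χ → q ≤ q₀

/-- (G⁻): none. -/
def GateMinus (A : ℝ) : Prop :=
  ∀ (q : ℕ) [NeZero q] (χ : DirichletCharacter ℂ q), ¬ Exceptional A q χ

/-- The gate is a trichotomy. -/
theorem gate_trichotomy (A : ℝ) : GatePlus A ∨ GateZero A ∨ GateMinus A := by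
  by_cases hP : GatePlus A
  · exact Or.inl hP
  · right
    simp only [GatePlus, not_forall, not_exists, not_and] at hP
    obtain ⟨q₀, hq₀⟩ := hP
    by_cases hE : ∃ (q : ℕ) (_ : NeZero q) (χ : DirichletCharacter ℂ q), Exceptional A q χ
    · exact Or.inl ⟨hE, q₀, fun q _ χ hχ ↦ not_lt.mp fun hlt ↦ hq₀ q ‹_› χ hlt hχ⟩
    · exact Or.inr fun q _ χ hχ ↦ hE ⟨q, ‹_›, χ, hχ⟩

/-- **The Deuring door (LOG strength; named OPEN door)**: an exceptional modulus forces RH for `ζ` up to height `W q`.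
[cite: ConreyIwaniec2002, Thm 1.2, Prop 10.1, §1 remark "it is not hard to include other zeros in the critical strip"] -/
def DeuringDoor (A : ℝ) (W : ℕ → ℝ) : Prop :=
  ∀ (q : ℕ) [NeZero q] (χ : DirichletCharacter ℂ q), Exceptional A q χ → RiemannHypothesisUpTo (W q)

/-- (G⁻) ⇒ the door is VACUOUS (blind at every height). -/
theorem deuringDoor_of_gateMinus {A : ℝ} (hM : GateMinus A) (W : ℕ → ℝ) : DeuringDoor A W :=
  fun q _ χ hχ ↦ (hM q χ hχ).elim

/-- (G⁰) ⇒ the door's content is RH up to ONE fixed height (verified-height type; blind above it). -/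
theorem deuringDoor_of_gateZero {A : ℝ} (hZ : GateZero A) {W : ℕ → ℝ} :
    ∃ H₀ : ℝ, RiemannHypothesisUpTo H₀ → DeuringDoor A W := by
  obtain ⟨-, q₀, hq₀⟩ := hZ
  refine ⟨(Finset.range (q₀ + 1)).sup' ⟨0, by simp⟩ (fun q ↦ W q), fun hRH q _ χ hχ ↦ ?_⟩
  exact RiemannHypothesisUpTo.mono_of_le
    (Finset.le_sup' (fun q ↦ W q) (Finset.mem_range.mpr (Nat.lt_succ_of_le (hq₀ q χ hχ)))) hRH

/-- The door is RH-implied (so it is weightless as a crux; critic's probe). -/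
theorem deuringDoor_of_riemannHypothesis (h : _root_.RiemannHypothesis) (A : ℝ) (W : ℕ → ℝ) : DeuringDoor A W :=
  fun q _ _ _ ↦ RiemannHypothesisUpTo.of_riemannHypothesis h (W q)

/-- (G⁺), cofinal form: exceptional moduli with arbitrarily high windows. -/
def GatePlusCofinal (A : ℝ) (W : ℕ → ℝ) : Prop :=
  ∀ H : ℝ, ∃ (q : ℕ) (_ : NeZero q) (χ : DirichletCharacter ℂ q), Exceptional A q χ ∧ H ≤ W q

/-- (G⁺) at strength `A` with windows `W q → ∞` gives the cofinal form. -/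
theorem gatePlusCofinal_of_gatePlus {A : ℝ} {W : ℕ → ℝ} (hW : Tendsto W atTop atTop) (hP : GatePlus A) :
    GatePlusCofinal A W := fun H ↦ by
  obtain ⟨N, hN⟩ := eventually_atTop.mp (hW.eventually_ge_atTop H)
  obtain ⟨q, _, χ, hlt, hχ⟩ := hP N
  exact ⟨q, ‹_›, χ, hχ, hN q hlt.le⟩

/-- **(G⁺) ⇒ RH — Heilbronn's 1934 play, typed** (the world in which Z3 sees towers at unbounded height is the world
in which it proves RH; GRH forbids it). Nothing here bears on the truth of RH. -/
theorem summit_of_gatePlusCofinal_of_deuringDoor {A : ℝ} {W : ℕ → ℝ}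
    (hG : GatePlusCofinal A W) (hD : DeuringDoor A W) : Summit.RiemannHypothesis := by
  refine riemannHypothesis_of_forall_riemannHypothesisUpTo_holds fun T ↦ ?_
  obtain ⟨q, _, χ, hχ, hT⟩ := hG T
  exact RiemannHypothesisUpTo.mono_of_le hT (hD q χ hχ)

/-- Power-strength (G⁺): infinitely many real primitive `χ` mod `q > 4` with `|L(1,χ)| ≤ q^{-η}`. -/
def GatePlusPow (η : ℝ) : Prop :=
  ∀ q₀ : ℕ, ∃ (q : ℕ) (_ : NeZero q) (χ : DirichletCharacter ℂ q),
    q₀ < q ∧ 4 < q ∧ χ.IsPrimitive ∧ χ.IsQuadratic ∧ ‖χ.LFunction 1‖ ≤ (q : ℝ) ^ (-η)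

/-- **Siegel shuts the power gate — unconditional** (tree: `siegel_lower_bound_holds`, ineffective). [cite: Siegel1935] -/
theorem not_gatePlusPow {η : ℝ} (hη : 0 < η) : ¬ GatePlusPow η := by
  intro hG
  obtain ⟨C, hC, H⟩ := siegel_lower_bound_holds (η / 2) (by linarith)
  obtain ⟨q₀, hq₀⟩ := exists_nat_gt ((1 / C) ^ (2 / η))
  obtain ⟨q, _, χ, hlt, hq4, hp, hQ, hL⟩ := hG q₀
  have hqpos : (0 : ℝ) < q := by exact_mod_cast (show 0 < q by omega)
  have key : C * (q : ℝ) ^ (-(η / 2)) ≤ (q : ℝ) ^ (-η) :=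
    (H q (by omega) χ hQ hp).trans (((le_abs_self _).trans (Complex.abs_re_le_norm _)).trans hL)
  have e1 : (q : ℝ) ^ (-(η / 2)) * (q : ℝ) ^ η = (q : ℝ) ^ (η / 2) := by
    rw [← Real.rpow_add hqpos]; congr 1; ring
  have e2 : (q : ℝ) ^ (-η) * (q : ℝ) ^ η = 1 := by rw [← Real.rpow_add hqpos]; simp
  have hle : C * (q : ℝ) ^ (η / 2) ≤ 1 := by
    calc C * (q : ℝ) ^ (η / 2) = (C * (q : ℝ) ^ (-(η / 2))) * (q : ℝ) ^ η := by rw [mul_assoc, e1]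
      _ ≤ (q : ℝ) ^ (-η) * (q : ℝ) ^ η := mul_le_mul_of_nonneg_right key (Real.rpow_pos_of_pos hqpos η).le
      _ = 1 := e2
  have hback : ((1 / C) ^ (2 / η)) ^ (η / 2) = 1 / C := by
    rw [← Real.rpow_mul (by positivity), show 2 / η * (η / 2) = 1 by field_simp, Real.rpow_one]
  have hgt : 1 / C < (q : ℝ) ^ (η / 2) := by
    rw [← hback]
    exact Real.rpow_lt_rpow (by positivity) (hq₀.trans (by exact_mod_cast hlt)) (by positivity)
  rw [div_lt_iff₀ hC] at hgt
  linarith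

/-- **BRIDGE: the power-strength door is the tree's Watkins reading** — `Watkins2021.DeuringSpacing D₀` forces RH for `ζ`
up to `Watkins2021.height χ 1` for every Watkins-exceptional `χ` of conductor `≥ D₀` (and `∃ D₀` holds by vacuity,
`Watkins2021.exists_deuringSpacing`). [cite: Watkins2021DeuringZeroSpacing, Thm 1.1] -/
theorem rhUpTo_of_deuringSpacing {D₀ : ℝ} (h : Watkins2021.DeuringSpacing D₀) {D : ℕ} [NeZero D] (hD : D₀ ≤ D)
    {χ : DirichletCharacter ℂ D} (hq : χ.IsQuadratic) (hp : χ.IsPrimitive) (hexc : Watkins2021.IsExceptional χ)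
    (hlev : (1 : ℝ) ≤ Watkins2021.levelBound χ) : RiemannHypothesisUpTo (Watkins2021.height χ 1) :=
  fun _ hs him hle ↦ h.riemannZeta_re_eq_half hD hq hp hexc hlev hs him.ne' (by rwa [abs_of_pos him])

end Summit.RiemannHypothesis.RiemannHypothesis.Theorems.Splittings.SiegelGate

end
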